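import Literature.NumberTheory.Automorphic.QuaternionAlgebraUniqueness
import Literature.NumberTheory.QuadraticForms.LocalNormIndex
import Literature.NumberTheory.QuadraticForms.HasseNormTheoremHolds
import HarnessLib

/-!
# The local–global principle for isomorphism of quaternion algebras over a number field holds —
# discharge of `nonempty_algEquiv_of_completions` (Vignéras III §3 Thm. 3.1)

Topic `NumberTheory/Automorphic`; sibling proof file of `QuaternionAlgebraClassification`,
discharging its named fact

* `nonempty_algEquiv_of_completions K D` : two quaternion algebras `D`, `D'` over a number field `K`
  with `K_v ⊗_K D ≃ K_v ⊗_K D'` over `K_v` for every finite place `v` and `K_w ⊗_K D ≃ K_w ⊗_K D'`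
  over `K_w` for every infinite place `w` are `K`-isomorphic (Vignéras, LNM 800, Ch. III §3,
  Théorème 3.1 in its exact-sequence form `1 → Quat(K) →ⁱ ⊕_v Quat(K_v) →ᵉ {±1} → 1`, PDF p. 65 of
  the held copy: exactness at `Quat(K)`, i.e. injectivity of `i : H ↦ (H_v)_v`),

as `nonempty_algEquiv_of_completions_holds`, together with the intermediate named fact of the same
decomposition that it passes through,

* `exists_common_quadratic_subfield K D` (`QuaternionAlgebraHasse`; Vignéras III §3 Thm. 3.8,
  second assertion: two quaternion algebras over `K` have a common quadratic subfield), as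
  `exists_common_quadratic_subfield_holds`

(the first assertion of Thm. 3.8, `exists_sq_eq_of_not_isSquare_ramified K D`, is discharged in
the sibling `QuaternionAlgebraEmbeddingHolds` as `exists_sq_eq_of_not_isSquare_ramified_holds`; this
file keeps a `private` three-line copy `exists_sq_eq_of_not_isSquare_ramified_holds'` of that
assembly so as to depend only on `QuadraticForms/LocalNormIndex` and
`QuadraticForms/HasseNormTheoremHolds`).

Nothing is restated and no hypothesis is added: the file only composes results already proved in
the tree, along the printed proof (III §3, PDF pp. 65–68):

1. **Cor. 3.4** (Hasse's norm theorem for quadratic extensions, `θ ∈ n(L) ⇔ θ ∈ n(L_v) ∀ v`) is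
   the theorem `hilbertSymbol_eq_one_of_forall_completions_holds` of
   `QuadraticForms/HasseNormTheoremHolds` (O'Meara §65: unit norm index 65:10, first inequality
   65:14, norm index theorem 65:21 = Vignéras III Thm. 3.7, 65:23 = Cor. 3.4), for *every* number
   field — it is used below over `K` and over the quadratic extensions `L` of `K`;
2. **Thm. 3.8 (1)** from Cor. 3.4 and the local norm indices (O'Meara 63:13a, proved):
   `QuadraticForms.exists_sq_eq_of_not_isSquare_ramified_of_hasseNorm` (`QuadraticForms/LocalNormIndex`;
   packaged as `exists_sq_eq_of_not_isSquare_ramified_holds` in `QuaternionAlgebraEmbeddingHolds`);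
3. **Thm. 3.8 (2)** from Thm. 3.8 (1), Lemme 3.6 and the finiteness of ramification
   (`ramifiedPlaces_finite_holds`, `QuaternionAlgebraAdelicRamificationProofs`):
   `exists_common_quadratic_subfield_of_facts` (`QuaternionAlgebraHasse`);
4. **Thm. 3.1, injectivity of `i`**, from Thm. 3.8 (2) and Cor. 3.4 — common quadratic subfield
   `L = K(√a)`, `D ≃ {L,θ}`, `D' ≃ {L,θ'}` (I Cor. 2.2), locally `θ'/θ ∈ n(L_v)`, hence
   `θ'/θ ∈ n(L)` and `{L,θ'} ≃ {L,θ}` (I §1 rescaling):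
   `nonempty_algEquiv_of_completions_of_facts` (`QuaternionAlgebraUniqueness`, whose local step and
   rescaling are proved in `QuaternionAlgebraHasse`).

## Design notes

* The discharge cannot be appended to `QuaternionAlgebraClassification` itself: that file is
  imported by `QuaternionAlgebraUniqueness` and, through `QuaternionAlgebraEmbeddingProofs` and
  `QuadraticForms/LocalNormIndex`, by the whole `HasseNormTheorem` chain, so an in-place proof would
  close an import cycle. This leaf file imports the three end points instead.
* Universe levels follow the named facts: `nonempty_algEquiv_of_completions.{u, v} K D` and
  `exists_common_quadratic_subfield.{u, v} K D` quantify over `D' : Type v` for `D : Type u`.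
* Consumers holding `(hH : nonempty_algEquiv_of_completions K D)` (e.g.
  `nonempty_algEquiv_of_ramifiedPlaces_eq_of_facts`) are fed `nonempty_algEquiv_of_completions_holds K D`.

## References

* M.-F. Vignéras, *Arithmétique des algèbres de quaternions*, LNM 800 (1980), Ch. III §3:
  Thm. 3.1 (PDF p. 65), Cor. 3.4 (PDF p. 66), Lemme 3.6, Thm. 3.7, Thm. 3.8 (PDF p. 68).
  [VignerasLNM800]
* O. T. O'Meara, *Introduction to quadratic forms*, Grundlehren 117 (1963), §63B (63:13a), §65
  (65:10, 65:14, 65:21, 65:23). [Omeara1963]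
-/

noncomputable section

open NumberField IsDedekindDomain

universe u v

namespace Literature.NumberTheory.Automorphic

variable (K : Type) [Field K] [NumberField K] (D : Type u) [Ring D] [Algebra K D]

/-- **Vignéras III §3 Thm. 3.8, first assertion, holds** — private local copy of
`exists_sq_eq_of_not_isSquare_ramified_holds` (`QuaternionAlgebraEmbeddingHolds`): for `a ∉ K²` a
non-square at every place ramified in `D`, `K(√a) ↪ D`. Proof:
`QuadraticForms.exists_sq_eq_of_not_isSquare_ramified_of_hasseNorm` (local norm indices, O'Meara
63:13a) fed with Hasse's norm theorem `hilbertSymbol_eq_one_of_forall_completions_holds L` over the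
quadratic extensions `L` of `K` (Cor. 3.4). [cite: VignerasLNM800, Ch. III §3 Thm. 3.8] -/
private theorem exists_sq_eq_of_not_isSquare_ramified_holds' :
    exists_sq_eq_of_not_isSquare_ramified K D :=
  QuadraticForms.exists_sq_eq_of_not_isSquare_ramified_of_hasseNorm K D
    fun L _ _ _ c d ↦ hilbertSymbol_eq_one_of_forall_completions_holds L c d

/-- **Vignéras III §3 Thm. 3.8, second assertion, holds** (discharge of
`exists_common_quadratic_subfield`; *Deux algèbres de quaternions ont toujours des sous-corps
commutatifs maximaux communs*): two quaternion algebras `D`, `D'` over the number field `K` contain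
a common quadratic field `K(√a)`, `a ∉ K²`. Proof: `exists_common_quadratic_subfield_of_facts`
(Lemme 3.6 and Thm. 3.8 (1), `QuaternionAlgebraHasse`/`QuaternionAlgebraEmbedding`) fed with
Thm. 3.8 (1) for `D` and `D'` (`exists_sq_eq_of_not_isSquare_ramified_of_hasseNorm` and Hasse's norm
theorem `hilbertSymbol_eq_one_of_forall_completions_holds`, cf. `QuaternionAlgebraEmbeddingHolds`)
and with the finiteness of ramification `ramifiedPlaces_finite_holds`
(`QuaternionAlgebraAdelicRamificationProofs`, Vignéras III §1 Lemme 1.1).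
[cite: VignerasLNM800, Ch. III §3 Thm. 3.8] -/
theorem exists_common_quadratic_subfield_holds : exists_common_quadratic_subfield.{u, v} K D :=
  exists_common_quadratic_subfield_of_facts K D (exists_sq_eq_of_not_isSquare_ramified_holds' K D)
    (ramifiedPlaces_finite_holds K D)
    (fun D' _ _ ↦ exists_sq_eq_of_not_isSquare_ramified_holds' K D')
    fun D' _ _ ↦ ramifiedPlaces_finite_holds K D'

/-- **Vignéras III §3 Thm. 3.1, injectivity of `Quat(K) → ⊕_v Quat(K_v)`, holds** (discharge of
`nonempty_algEquiv_of_completions`, the local–global principle for isomorphism of quaternion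
algebras): if two quaternion algebras `D`, `D'` over the number field `K` become isomorphic over
every completion `K_v` (`v` finite) and `K_w` (`w` infinite), then `D ≃ₐ[K] D'`. Proof:
`nonempty_algEquiv_of_completions_of_facts` (`QuaternionAlgebraUniqueness`: common quadratic
subfield `L = K(√a)`, `D ≃ {L,θ}`, `D' ≃ {L,θ'}` by I Cor. 2.2, locally `θ'/θ ∈ n(L_v)`, globally
by Cor. 3.4, then the rescaling `{L,θ n(m)} ≃ {L,θ}` of I §1) fed with
`exists_common_quadratic_subfield_holds K D` (Thm. 3.8 (2)) and Hasse's norm theorem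
`hilbertSymbol_eq_one_of_forall_completions_holds K` (Cor. 3.4). Unconditional: the axiom closure
is the standard one. [cite: VignerasLNM800, Ch. III §3 Thm. 3.1] -/
theorem nonempty_algEquiv_of_completions_holds : nonempty_algEquiv_of_completions.{u, v} K D :=
  nonempty_algEquiv_of_completions_of_facts K D (exists_common_quadratic_subfield_holds.{u, v} K D)
    fun a θ ↦ hilbertSymbol_eq_one_of_forall_completions_holds K a θ

end Literature.NumberTheory.Automorphic
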